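import Literature.Barriers.QuantumAdvantage.SampPRelSubsetSampBQPRel
import Literature.Computability.QuantumComplexity.CoinFamilyKernelProofs

/-!
# Discharge of named literature fact(s) by composition

This file only composes reductions and discharges that are already in the tree
(no new definitions, no new named facts): each `theorem X_holds : X` below feeds the
proved hypotheses into an existing reduction theorem.  Net effect: the listed facts
stop being literature debt.
-/

namespace Literature.Barriers.QuantumAdvantage

/-- Discharge of `SampPRel_subset_SampBQPRel` from the proved uniform oracle coin simulation
`uniformOracleCoinSimulation_holds` via `SampPRel_subset_SampBQPRel_of_sim`.
[cite: AaronsonChen2017, Def. 2.3 (oracle versions of SampBPP, SampBQP)] [cite: AaronsonArkhipov2013, §2 (remark after Def. 2.7)] -/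
theorem SampPRel_subset_SampBQPRel_holds : SampPRel_subset_SampBQPRel :=
  SampPRel_subset_SampBQPRel_of_sim
    Literature.Computability.QuantumComplexity.uniformOracleCoinSimulation_holds

end Literature.Barriers.QuantumAdvantage
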